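import Literature.NumberTheory.Transcendental.RoySmallValueEstimatesDeterminantKProofs
import Literature.NumberTheory.Automorphic.ProjectiveElimination
import HarnessLib

/-!
# Small value estimates at rational translates (Nguyen–Roy 2016) — proofs, XVI: Lemma 5.1 with a zero-free last form

Sixteenth proofs file towards `Literature.NumberTheory.Transcendental.nguyenRoy2016_thm_1` (Nguyen–Roy,
IJNT 12 (2016) = arXiv:1412.5163), in the generic-field setting of files XIV–XV. Roy's proof of the
multiplicity estimate (Mathematika 59 (2013) = arXiv:1301.0663, Theorem 5.2) starts from "a regular
sequence `P₀, …, P_{m−1}` of length `m`" inside `I_D` and extends it "as the elements of `ℂ[X]_D` have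
no common zeros" to a regular sequence `P₀, …, P_m`; the extension step silently uses the unmixedness
of complete intersections (Macaulay). This file PROVES a replacement that avoids unmixedness: the
decomposition data of Lemma 5.1 (`NguyenRoyK.DecompData`, file XV) exist as soon as `P₀, …, P_{m−1}`
is regular and `P_m` has no common zero with them, in every large degree `ν`:

* `map_inf_idealDeg_eq_of_full` — if `(P₀,…,P_m)_ν = K[x]_ν` then
  `K[x]_{ν−D} P_m ∩ (I_m)_ν = (I_m)_{ν−D} P_m` by a DIMENSION COUNT (Grassmann, and the Hilbert
  function of `I_m = (P₀,…,P_{m−1})` takes the value `D^m` at `ν − D` and at `ν`, file X);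
* `nonempty_decompData_of_full` — hence the conclusion of Lemma 5.1 (file X's induction with the top
  step fed by the previous lemma);
* `exists_forall_idealDeg_eq_top` — `(P₀,…,P_m)_ν = K[x]_ν` for all large `ν` when the `P_j` have no
  common projective zero (`K` algebraically closed; the tree's projective Nullstellensatz
  `Literature.NumberTheory.Automorphic.exists_forall_monomial_mem_of_forall_zero`);
* `exists_forall_nonempty_decompData` — the two combined.

No definitions besides the proof objects; no named facts.

## References

* [Roy2013] D. Roy, *A small value estimate for 𝔾ₐ × 𝔾ₘ*, Mathematika 59 (2013) = arXiv:1301.0663,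
  §5: Lemma 5.1, Theorem 5.2 and its proof (p. 13 of the arXiv text).
* [NguyenRoy2016] N. A. V. Nguyen, D. Roy, IJNT 12 (2016) = arXiv:1412.5163, §4.
-/

noncomputable section

open MvPolynomial Finset

attribute [local instance] MvPolynomial.gradedAlgebra

namespace Literature.NumberTheory.Transcendental

namespace NguyenRoyK

open NguyenRoy (MonoIdx monoIdxEquivSym fintypeMonoIdx card_monoIdx veroN veroN_succ veroEquiv vexp
  degree_vexp vidx vexp_vidx vexp_injective nuD nuD_spec specForm isHomogeneous_specForm aeval_specForm
  eq_zero_of_forall_coeff)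

attribute [local instance] NguyenRoy.fintypeMonoIdx

/-! ## Lemma 5.1 with a zero-free last form (the input of Theorem 5.2 without unmixedness) -/

section ZeroFree

attribute [local instance] NguyenRoy.finiteDimensional_homogeneousSubmodule

open NguyenRoy (idealUpTo idealDeg hilbFun mem_idealDeg_iff idealDeg_le idealDeg_succ hilbFun_eq_pow
  exists_compl_le existsUnique_decomp self_mem_idealUpTo)

variable {K : Type*} [Field K] {m D : ℕ}

/-- **The key intersection identity without regularity of the last form.** If `P₀, …, P_{m−1}`
is a regular sequence of forms of degree `D`, `P_m ≠ 0` is a further form of degree `D`, and in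
degree `ν` (with `ν − D ≥ mD − m`) the forms `P₀, …, P_m` generate everything,
`(P₀, …, P_m)_ν = K[x]_ν`, then `K[x]_{ν−D}·P_m ∩ (I_m)_ν = (I_m)_{ν−D}·P_m` (`I_m = (P₀,…,P_{m−1})`):
by Grassmann's formula the left side has dimension `dim K[x]_{ν−D} + dim (I_m)_ν − dim K[x]_ν`,
which is the dimension `dim (I_m)_{ν−D}` of the right side because the Hilbert function of `I_m`
takes the same value `D^m` at `ν − D` and at `ν` (Lemma 5.1 numerics, file X). This replaces the
regularity of `P_m` modulo `I_m` (Macaulay's unmixedness) in Roy's argument. [cite: Roy2013, Lemma 5.1 and proof of Theorem 5.2] -/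
theorem map_inf_idealDeg_eq_of_full (hD : 1 ≤ D) {P : ℕ → MvPolynomial (Fin (m + 1)) K}
    (hP : ∀ j, (P j).IsHomogeneous D)
    (hreg : ∀ j < m, ∀ F, P j * F ∈ idealUpTo P j → F ∈ idealUpTo P j) (hPm : P m ≠ 0)
    {ν : ℕ} (hν : m * D + D ≤ ν + m)
    (hfull : idealDeg P (m + 1) ν = homogeneousSubmodule (Fin (m + 1)) K ν) :
    (homogeneousSubmodule (Fin (m + 1)) K (ν - D)).map (LinearMap.mulRight K (P m)) ⊓ idealDeg P m ν =
      (idealDeg P m (ν - D)).map (LinearMap.mulRight K (P m)) := by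
  classical
  have hmD : m ≤ m * D := Nat.le_mul_of_pos_right _ hD
  have hDν : D ≤ ν := by omega
  set U := (homogeneousSubmodule (Fin (m + 1)) K (ν - D)).map (LinearMap.mulRight K (P m)) with hU
  set W := idealDeg P m ν with hW
  set V₀ := (idealDeg P m (ν - D)).map (LinearMap.mulRight K (P m)) with hV₀
  -- `V₀ ≤ U ⊓ W`
  have hle : V₀ ≤ U ⊓ W := by
    rintro _ ⟨A, hA, rfl⟩
    have hA' := mem_idealDeg_iff.mp hA
    refine ⟨⟨A, hA'.2, rfl⟩, ?_⟩
    rw [SetLike.mem_coe, mem_idealDeg_iff, LinearMap.mulRight_apply]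
    refine ⟨Ideal.mul_mem_right _ _ hA'.1, ?_⟩
    have := hA'.2.mul (hP m)
    rwa [Nat.sub_add_cancel hDν] at this
  -- finite-dimensionality
  haveI : FiniteDimensional K W := Submodule.finiteDimensional_of_le (idealDeg_le P m ν)
  haveI : FiniteDimensional K (idealDeg P m (ν - D)) :=
    Submodule.finiteDimensional_of_le (idealDeg_le P m (ν - D))
  haveI : FiniteDimensional K ↥(U ⊓ W) := Submodule.finiteDimensional_of_le inf_le_right
  -- dimensions
  have hsup : U ⊔ W = homogeneousSubmodule (Fin (m + 1)) K ν := by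
    rw [hU, hW, ← idealDeg_succ hP m hDν, hfull]
  have hG := Submodule.finrank_sup_add_finrank_inf_eq U W
  have hinj : Function.Injective (LinearMap.mulRight K (P m)) := mul_left_injective₀ hPm
  have hUdim : Module.finrank K U = Module.finrank K (homogeneousSubmodule (Fin (m + 1)) K (ν - D)) :=
    (Submodule.equivMapOfInjective _ hinj _).finrank_eq.symm
  have hV₀dim : Module.finrank K V₀ = Module.finrank K (idealDeg P m (ν - D)) :=
    (Submodule.equivMapOfInjective _ hinj _).finrank_eq.symm
  have hsupdim : Module.finrank K ↥(U ⊔ W) = Module.finrank K (homogeneousSubmodule (Fin (m + 1)) K ν) := by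
    rw [hsup]
  have h1 : hilbFun P m ν = (D : ℤ) ^ m := hilbFun_eq_pow hD hP hreg (ν := ν) (by omega)
  have h2 : hilbFun P m (ν - D) = (D : ℤ) ^ m := hilbFun_eq_pow hD hP hreg (ν := ν - D) (by omega)
  unfold hilbFun at h1 h2
  refine (Submodule.eq_of_le_of_finrank_eq hle ?_).symm
  rw [hV₀dim]
  rw [hsupdim, hUdim] at hG
  have hG' : (Module.finrank K (homogeneousSubmodule (Fin (m + 1)) K ν) : ℤ) +
      Module.finrank K ↥(U ⊓ W) =
      Module.finrank K (homogeneousSubmodule (Fin (m + 1)) K (ν - D)) + Module.finrank K W := by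
    exact_mod_cast hG
  have : (Module.finrank K (idealDeg P m (ν - D)) : ℤ) = Module.finrank K ↥(U ⊓ W) := by
    rw [hW] at hG'
    linarith
  exact_mod_cast this

/-- **Lemma 5.1 for a regular sequence completed by a zero-free form**: under the hypotheses of
`map_inf_idealDeg_eq_of_full`, there are decomposition data `E₀, …, E_m ⊆ K[x]_{ν−D}`,
`dim E_m = D^m`, `K[x]_ν = ⊕ E_j P_j` uniquely (`NguyenRoyK.DecompData`). The proof is that of
Lemma 5.1 (file X) with the top step fed by `map_inf_idealDeg_eq_of_full`. [cite: Roy2013, Lemma 5.1 and proof of Theorem 5.2] -/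
theorem nonempty_decompData_of_full (hD : 1 ≤ D) {P : ℕ → MvPolynomial (Fin (m + 1)) K}
    (hP : ∀ j, (P j).IsHomogeneous D)
    (hreg : ∀ j < m, ∀ F, P j * F ∈ idealUpTo P j → F ∈ idealUpTo P j) (hPm : P m ≠ 0)
    {ν : ℕ} (hν : m * D + D ≤ ν + m)
    (hfull : idealDeg P (m + 1) ν = homogeneousSubmodule (Fin (m + 1)) K ν) :
    Nonempty (DecompData K m D ν P) := by
  classical
  have hmD : m ≤ m * D := Nat.le_mul_of_pos_right _ hD
  have hDν : D ≤ ν := by omega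
  choose E hE using fun j : ℕ => exists_compl_le (K := K) (idealDeg P j (ν - D))
    (homogeneousSubmodule (Fin (m + 1)) K (ν - D)) (idealDeg_le P j (ν - D))
  have hEle : ∀ j, E j ≤ homogeneousSubmodule (Fin (m + 1)) K (ν - D) := fun j => (hE j).1
  -- `dim E_m = D^m`
  have hfin : Module.finrank K (E m) = D ^ m := by
    haveI : FiniteDimensional K (idealDeg P m (ν - D)) :=
      Submodule.finiteDimensional_of_le (idealDeg_le P m (ν - D))
    haveI : FiniteDimensional K (E m) := Submodule.finiteDimensional_of_le (hE m).1
    have hG := Submodule.finrank_sup_add_finrank_inf_eq (idealDeg P m (ν - D)) (E m)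
    rw [(hE m).2.1, (hE m).2.2, finrank_bot, add_zero] at hG
    have h := hilbFun_eq_pow hD hP hreg (ν := ν - D) (by omega)
    unfold hilbFun at h
    have : (Module.finrank K (E m) : ℤ) = (D : ℤ) ^ m := by push_cast [hG] at h ⊢; linarith
    exact_mod_cast this
  -- membership of partial sums
  have hsum_mem : ∀ (k : ℕ) (Q : Fin k → MvPolynomial (Fin (m + 1)) K), (∀ i : Fin k, Q i ∈ E i) →
      ∑ i, Q i * P i ∈ idealDeg P k ν := by
    intro k Q hQ
    rw [mem_idealDeg_iff]
    refine ⟨Ideal.sum_mem _ fun i _ => Ideal.mul_mem_left _ _ (self_mem_idealUpTo P i.isLt),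
      MvPolynomial.IsHomogeneous.sum _ _ _ fun i _ => ?_⟩
    have h1 : (Q i).IsHomogeneous (ν - D) := hEle i (hQ i)
    have := h1.mul (hP i)
    rwa [Nat.sub_add_cancel hDν] at this
  have hkey := map_inf_idealDeg_eq_of_full hD hP hreg hPm hν hfull
  refine ⟨{ E := fun j => E j, le := fun j => hEle j, finrank_last := ?_, unique := ?_ }⟩
  · show Module.finrank K (E ((Fin.last m : Fin (m + 1)) : ℕ)) = D ^ m
    rw [Fin.val_last]
    exact hfin
  intro F hF
  -- decompose at the top level
  have hF' : F ∈ idealDeg P (m + 1) ν := by rw [hfull]; exact hF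
  rw [idealDeg_succ hP m hDν, Submodule.mem_sup] at hF'
  obtain ⟨u, ⟨A, hA, rfl⟩, g, hg, hF'⟩ := hF'
  rw [SetLike.mem_coe, ← (hE m).2.2, Submodule.mem_sup] at hA
  obtain ⟨v, hv, e, he, rfl⟩ := hA
  have hG' : v * P m + g ∈ idealDeg P m ν := by
    refine Submodule.add_mem _ ?_ hg
    rw [mem_idealDeg_iff]
    have hv' := mem_idealDeg_iff.mp hv
    refine ⟨Ideal.mul_mem_right _ _ hv'.1, ?_⟩
    have := hv'.2.mul (hP m)
    rwa [Nat.sub_add_cancel hDν] at this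
  -- the lower levels, by Lemma 5.1 (file X)
  have hlow := existsUnique_decomp hD hP hDν E (fun j => (hE j).2) (k := m)
    (fun j hj => hreg j hj) hG'
  obtain ⟨Q', ⟨hQ'E, hQ'sum⟩, -⟩ := hlow
  have hcand : (∀ j : Fin (m + 1),
      (Fin.snoc (α := fun _ => MvPolynomial (Fin (m + 1)) K) Q' e j) ∈ E (j : ℕ)) ∧
      ∑ j : Fin (m + 1), Fin.snoc (α := fun _ => MvPolynomial (Fin (m + 1)) K) Q' e j * P j = F := by
    constructor
    · intro i
      induction i using Fin.lastCases with
      | last => simpa using he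
      | cast i => simpa using hQ'E i
    · rw [Fin.sum_univ_castSucc]
      simp only [Fin.snoc_castSucc, Fin.snoc_last, Fin.val_castSucc, Fin.val_last, hQ'sum]
      rw [← hF', LinearMap.mulRight_apply]
      ring
  refine ⟨Fin.snoc (α := fun _ => MvPolynomial (Fin (m + 1)) K) Q' e, hcand, ?_⟩
  -- uniqueness
  rintro Q₁ ⟨h₁, e₁⟩
  rw [Fin.sum_univ_castSucc] at e₁
  simp only [Fin.val_castSucc, Fin.val_last] at e₁
  set S₁ := ∑ i : Fin m, Q₁ (Fin.castSucc i) * P i with hS₁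
  have hS₁mem : S₁ ∈ idealDeg P m ν :=
    hsum_mem m (fun i => Q₁ (Fin.castSucc i)) fun i => h₁ (Fin.castSucc i)
  have hlast : Q₁ (Fin.last m) = e := by
    have hdiff : (Q₁ (Fin.last m) - e) * P m ∈
        (homogeneousSubmodule (Fin (m + 1)) K (ν - D)).map (LinearMap.mulRight K (P m)) ⊓
          idealDeg P m ν := by
      refine ⟨⟨Q₁ (Fin.last m) - e, Submodule.sub_mem _ (hEle m (h₁ (Fin.last m))) (hEle m he), rfl⟩, ?_⟩
      have : (Q₁ (Fin.last m) - e) * P m = (v * P m + g) - S₁ := by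
        rw [sub_mul]
        have : e * P m + (v * P m + g) = F := by rw [← hF', LinearMap.mulRight_apply]; ring
        linear_combination e₁ - this
      rw [SetLike.mem_coe, this]
      exact Submodule.sub_mem _ hG' hS₁mem
    rw [hkey] at hdiff
    obtain ⟨w, hw, hw'⟩ := hdiff
    rw [LinearMap.mulRight_apply] at hw'
    have hw'' : w = Q₁ (Fin.last m) - e := mul_left_injective₀ hPm hw'
    have hmem : Q₁ (Fin.last m) - e ∈ idealDeg P m (ν - D) ⊓ E m :=
      ⟨hw'' ▸ hw, Submodule.sub_mem _ (h₁ (Fin.last m)) he⟩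
    rw [(hE m).2.1, Submodule.mem_bot, sub_eq_zero] at hmem
    exact hmem
  have hS : S₁ = v * P m + g := by
    have : e * P m + (v * P m + g) = F := by rw [← hF', LinearMap.mulRight_apply]; ring
    rw [hlast] at e₁
    linear_combination e₁ - this
  have hinit : (fun i : Fin m => Q₁ (Fin.castSucc i)) = Q' := by
    have hu := existsUnique_decomp hD hP hDν E (fun j => (hE j).2) (k := m) (fun j hj => hreg j hj) hG'
    exact hu.unique ⟨fun i => h₁ (Fin.castSucc i), by rw [← hS]⟩ ⟨hQ'E, hQ'sum⟩
  funext i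
  induction i using Fin.lastCases with
  | last => rw [hlast, Fin.snoc_last]
  | cast i => rw [Fin.snoc_castSucc]; exact congrFun hinit i

/-! ### Fullness in large degree from the absence of common zeros (projective Nullstellensatz) -/

/-- Splitting an exponent of degree `≥ D₀` into a part of degree `D₀` and a rest. [folklore] -/
theorem exists_add_degree_eq {σ : Type*} (D₀ : ℕ) :
    ∀ (n : ℕ) (s : σ →₀ ℕ), s.degree = D₀ + n → ∃ s₁ s₂ : σ →₀ ℕ, s = s₁ + s₂ ∧ s₁.degree = D₀ := by
  classical
  intro n
  induction n with
  | zero => intro s hs; exact ⟨s, 0, by simp, by simpa using hs⟩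
  | succ n ih =>
    intro s hs
    have hs0 : s ≠ 0 := by
      intro h; rw [h, map_zero] at hs; omega
    obtain ⟨i, hi⟩ := Finsupp.ne_iff.mp hs0
    simp only [Finsupp.coe_zero, Pi.zero_apply] at hi
    set s' := s - Finsupp.single i 1 with hs'
    have hss' : s = s' + Finsupp.single i 1 := by
      ext j
      rw [Finsupp.add_apply, hs', Finsupp.tsub_apply, Finsupp.single_apply]
      split_ifs with hij
      · subst hij; omega
      · omega
    have hdeg : s'.degree = D₀ + n := by
      have := congrArg Finsupp.degree hss'
      rw [map_add, Finsupp.degree_single] at this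
      omega
    obtain ⟨s₁, s₂, h12, h1⟩ := ih s' hdeg
    exact ⟨s₁, s₂ + Finsupp.single i 1, by rw [hss', h12, add_assoc], h1⟩

/-- **`(P₀, …, P_m)_ν = K[x]_ν` for all large `ν`** when the forms `P₀, …, P_m` have no common zero
in `ℙ^m(K)`, `K` algebraically closed (projective Nullstellensatz, through the tree's
`Literature.NumberTheory.Automorphic.exists_forall_monomial_mem_of_forall_zero`). [folklore] -/
theorem exists_forall_idealDeg_eq_top [IsAlgClosed K] {P : ℕ → MvPolynomial (Fin (m + 1)) K}
    (h0 : ∀ x : Fin (m + 1) → K, (∀ j : Fin (m + 1), MvPolynomial.eval x (P j) = 0) → x = 0) :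
    ∃ ν₀ : ℕ, ∀ ν, ν₀ ≤ ν → idealDeg P (m + 1) ν = homogeneousSubmodule (Fin (m + 1)) K ν := by
  classical
  obtain ⟨D₀, hD₀⟩ := Literature.NumberTheory.Automorphic.exists_forall_monomial_mem_of_forall_zero
    (g := fun j : Fin (m + 1) => P j) h0
  refine ⟨D₀, fun ν hν => le_antisymm (idealDeg_le P (m + 1) ν) ?_⟩
  intro F hF
  rw [mem_idealDeg_iff]
  refine ⟨?_, hF⟩
  rw [← MvPolynomial.support_sum_monomial_coeff F]
  refine Ideal.sum_mem _ fun s hs => ?_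
  have hsdeg : s.degree = D₀ + (ν - D₀) := by
    rw [Nat.add_sub_cancel' hν]
    exact NguyenRoyK.degree_eq_of_mem_support hF hs
  obtain ⟨s₁, s₂, rfl, h1⟩ := exists_add_degree_eq D₀ (ν - D₀) s hsdeg
  have e1 : monomial (s₁ + s₂) (coeff (s₁ + s₂) F) =
      C (coeff (s₁ + s₂) F) * monomial s₂ 1 * monomial s₁ (1 : K) := by
    rw [mul_assoc, monomial_mul, mul_one, C_mul_monomial, mul_one, add_comm s₂ s₁]
  rw [e1]
  exact Ideal.mul_mem_left _ _ (hD₀ s₁ h1)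

/-- **Decomposition data for Theorem 5.2**: `K` algebraically closed, `P₀, …, P_{m−1}` a regular
sequence of forms of degree `D ≥ 1`, `P_m ≠ 0` a form of degree `D` with no common zero with them in
`ℙ^m(K)`; then for all large `ν` there are `E₀, …, E_m ⊆ K[x]_{ν−D}` with `dim E_m = D^m` and
`K[x]_ν = ⊕ E_j P_j`. [cite: Roy2013, Lemma 5.1 and proof of Theorem 5.2] -/
theorem exists_forall_nonempty_decompData [IsAlgClosed K] (hD : 1 ≤ D)
    {P : ℕ → MvPolynomial (Fin (m + 1)) K} (hP : ∀ j, (P j).IsHomogeneous D)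
    (hreg : ∀ j < m, ∀ F, P j * F ∈ idealUpTo P j → F ∈ idealUpTo P j) (hPm : P m ≠ 0)
    (h0 : ∀ x : Fin (m + 1) → K, (∀ j : Fin (m + 1), MvPolynomial.eval x (P j) = 0) → x = 0) :
    ∃ ν₀ : ℕ, ∀ ν, ν₀ ≤ ν → Nonempty (DecompData K m D ν P) := by
  obtain ⟨ν₁, hν₁⟩ := exists_forall_idealDeg_eq_top h0
  refine ⟨max ν₁ (m * D + D), fun ν hν => ?_⟩
  exact nonempty_decompData_of_full hD hP hreg hPm (by omega) (hν₁ ν (le_of_max_le_left hν))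

end ZeroFree

end NguyenRoyK

end Literature.NumberTheory.Transcendental
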